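import Summits.BirchSwinnertonDyer.BirchSwinnertonDyer.Theorems.KimAtThreeDeepLowerS24DeepAtOne
import Summits.BirchSwinnertonDyer.Rank1Residual.GaloisImage.SakamotoN11InstanceResidualAtOne
import Summits.BirchSwinnertonDyer.Rank1Residual.GaloisImage.SakamotoN11InstanceDeepTower
import HarnessLib

/-!
# [S24] Thm. 4.4 (1) at `m = 1` on `(E[3], 𝓕̄_can)` for a Kolyvagin datum with DEEP primes
# `frobeniusClassPrimes (E[3^{k′}·3]) S τ 3^{k′+1}` — UNCONDITIONAL (no S24-DEEP port), from surj(3)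
# alone; and the rigidity at a GENERAL core vertex that `TorsionLevel.…_allDepths_le` consumes
# (route `KimAtThreeKolyvagin`, rung W2; cell `bsd-addord`, seat `bsd-addord-w2-c2` gen 5)

HONEST FRAMING. Theorems only (no definition, no named fact, no `sorry`); nothing booked, no mark moved;
BSD is not proved by any of this. n1011's `kolyvaginSystems_freeRankOne_propagatedSelmerStructureOne_of_surj_atOne`
(cell `b2b-bsdres`, p13 / FILE F) is [S24] Thm. 4.4 (1) at `m = 1` on `(E[3], 𝓕̄_can)` for the PINNED
class `frobeniusClassPrimes (E[3]) S τ 3`; n1011's `kolyvaginSystem_eq_zero_of_apply_empty_eq_zero_of_baseRigidity_deep`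
is the rigidity at the core vertex `∅` on a DEEP-class datum (three-class Chebotarev only). Here, with
this seat's deep Lemma 5.2 (`KimAtThreeDeepLowerS24DeepPrimeChoice`) feeding the connectedness of the
core graph through `KimAtThreeDeepLowerS24DeepAtOne.kolyvaginSystems_freeRankOne_zmod_three_pow_deep_at_one`:

* §1 **`kolyvaginSystems_freeRankOne_propagatedSelmerStructureOne_deep_atOne_of_surj`** — for
  `D.primes = frobeniusClassPrimes (E[3^{k′}·3]) {v | inr v ∈ S} τ 3^{k′+1}` (ANY `k′`), `KS₁(E[3], 𝓕̄_can, 𝒫′)`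
  is free of rank one over `𝔽₃` and `κ ↦ κ_d` is bijective at every level `d` with `λ^*(d) = 0`.
  Binders: surj(3), the deepest `τ`-datum (`τ ∈ Γ_{ℚ(μ_{3^{k′+1}})}`, `E[3]/(τ−1) ≃ ℤ/3`), the
  Poitou–Tate family ×4, `hEP`, `S ⊇ ∞ ∪ {3} ∪ {bad}`, the datum (`hP`, `hT`, `hD`). NO port, NO tower.
* §2 **`kolyvaginSystem_eq_zero_of_apply_core_eq_zero_deep`** — on such a datum, a Kolyvagin system
  vanishing at ONE level `n₀` with `λ^*(n₀) = 0` vanishes identically: LITERALLY the `hinj₁` of n1011's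
  `TorsionLevel.apply_eq_zero_of_apply_eq_zero_allDepths_le` / `injective_eval_kolyvaginSystems_allDepths_le`
  for deep data at ANY core vertex (n1011 had it at `n₀ = ∅` only, `…_of_baseRigidity_deep`).

References: R. Sakamoto, JTNB **36** (2024) Thm. 4.4 (1) (p. 926), Lemma 5.2, Cor. 5.5, §6 [Sakamoto2024];
K. Rubin, PCMI 18 (2011) Cor. 2.8.9 [Rubin2011]; B. Mazur, K. Rubin, Mem. AMS **799** (2004) §3.5 (H.5),
Prop. A.2 [MazurRubin2004].
-/

set_option autoImplicit false
-- the Theorems namespace of a single-conjunct summit repeats the summit name by design (D-0017)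
set_option linter.dupNamespace false

noncomputable section

open scoped Classical NumberField ContRepresentation
open Function Field NumberField IsDedekindDomain
open WeierstrassCurve Literature.NumberTheory.EllipticCurves Literature.NumberTheory.EllipticCurves.Rank1Residual
  Literature.NumberTheory.GaloisRepresentations
  Literature.NumberTheory.GaloisRepresentations.DiscreteGaloisModule Literature.NumberTheory.GaloisCohomology

namespace Summit.BirchSwinnertonDyer.BirchSwinnertonDyer.Theorems.KimAtThreeDeepLowerS24DeepTorsionAtOne

open Summit.BirchSwinnertonDyer.Rank1Residual.GaloisImage
open Summit.BirchSwinnertonDyer.Rank1Residual.X11b.LocBridge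
open Summit.BirchSwinnertonDyer.BirchSwinnertonDyer.Theorems.KimAtThreeDeepLowerS24DeepAtOne

variable (W : WeierstrassCurve ℚ) [W.IsElliptic]

/-! ### §1 Thm. 4.4 (1) at `m = 1` on `(E[3], 𝓕̄_can)` with DEEP primes — unconditional -/

/-- **[S24] Thm. 4.4 (1) at `m = 1` on `(E[3], 𝓕̄_can)` for a datum with DEEP primes
`frobeniusClassPrimes (E[3^{k′}·3]) {v | inr v ∈ S} τ 3^{k′+1}`, from surj(3) ALONE** (n1011's
`kolyvaginSystems_freeRankOne_propagatedSelmerStructureOne_of_surj_atOne`, verbatim, with the pinned slice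
theorem replaced by this seat's DEEP slice theorem `kolyvaginSystems_freeRankOne_zmod_three_pow_deep_at_one`;
`T = T̄ = E[3]`, identity residual pair, `T′ = E[3^{k′}·3]` with `ker ≤ ker` by
`S24Deep.torsionGaloisModule_eq_one_of_dvd`, (H.3′) on the deep group by `hH3_three_pow_of_irr`, `T′`
unramified outside `S ⊇ ∞ ∪ {3} ∪ {bad}` by `not_mem_and_isUnramifiedAt_of_not_mem`). CONCLUSION:
`KS₁(E[3], 𝓕̄_can, 𝒫′)` is free of rank one over `𝔽₃` and `κ ↦ κ_d` is a bijection onto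
`H¹_{𝓕̄_can(d)}(ℚ, E[3])` at every level `d` of the deep datum with `λ^*(d) = 0`. NO port; no tower.
[cite: Sakamoto2024, Thm. 4.4 (1) (p. 926), Lemma 5.2 and Cor. 5.5 (pp. 928–930)] [cite: Rubin2011, Cor. 2.8.9 (2) (p. 25)]
[cite: MazurRubin2004, §3.5 (H.5) (p. 27) and Prop. A.2 (pp. 79–80)] -/
theorem kolyvaginSystems_freeRankOne_propagatedSelmerStructureOne_deep_atOne_of_surj
    [Finite (geomTorsion W ((3 : ℕ) : ℤ))]
    (h3 : W.HasSurjectiveModNGaloisRep ((3 : ℕ) : ℤ)) (k' : ℕ)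
    (τ : absoluteGaloisGroup ℚ) (hτμ : τ ∈ rootsOfUnityFixer ℚ (3 ^ (k' + 1)))
    (hτq : Nonempty (cokerSubOne (W.torsionGaloisModule ((3 : ℕ) : ℤ)) τ ≃+ ZMod 3))
    (inv : LocalInvariants ℚ 3) (hperf : inv.IsPerfect) (hsum : inv.SumLocalTermEqZero)
    (hunro : inv.UnramifiedOrthogonal) (hcompl : inv.SelmerComplement)
    (hEP : ∀ v : HeightOneSpectrum (𝓞 ℚ), localEulerPoincareCharacteristic (v.adicCompletion ℚ))
    (S : Finset (Place ℚ)) (hS : ∀ w : InfinitePlace ℚ, (Sum.inl w : Place ℚ) ∈ S)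
    (h3S : ∀ v : HeightOneSpectrum (𝓞 ℚ), ((3 : ℕ) : 𝓞 ℚ) ∈ v.asIdeal → (Sum.inr v : Place ℚ) ∈ S)
    (hbadS : ∀ v : HeightOneSpectrum (𝓞 ℚ), ¬ W.HasGoodReductionAt v → (Sum.inr v : Place ℚ) ∈ S)
    (D : KolyvaginDatum (W.torsionGaloisModule ((3 : ℕ) : ℤ)))
    (η : (q : HeightOneSpectrum (𝓞 ℚ)) → (ZMod (Ideal.absNorm q.asIdeal))ˣ)
    (hP : D.primes = frobeniusClassPrimes (W.torsionGaloisModule (((3 : ℕ) : ℤ) ^ k' * ((3 : ℕ) : ℤ)))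
      {v | (Sum.inr v : Place ℚ) ∈ S} τ (3 ^ (k' + 1)))
    (hT : D.transverse = cyclotomicTransverse (W.torsionGaloisModule ((3 : ℕ) : ℤ)))
    (hD : D.HasCanonicalComparison 3 η) :
    KolyvaginSystem.IsFreeRankOneZMod (D.kolyvaginSystems (propagatedSelmerStructureOne W 3)) 3 ∧
      ∀ (d : Finset (HeightOneSpectrum (𝓞 ℚ))) (hd : D.IsLevel d),
        LocalInvariants.lambdaStar inv (D.atLevel (propagatedSelmerStructureOne W 3) d) 3 = 0 →
        Function.Bijective fun κ : D.kolyvaginSystems (propagatedSelmerStructureOne W 3) =>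
          (⟨κ.1 d, ((KolyvaginDatum.mem_kolyvaginSystems_iff D _ κ.1).mp κ.2).mem_selmerGroup
              d hd⟩ : (D.atLevel (propagatedSelmerStructureOne W 3) d).selmerGroup) := by
  haveI : Fact (Nat.Prime 3) := ⟨Nat.prime_three⟩
  haveI : NeZero ((3 : ℕ) : ℚ) := ⟨by norm_num⟩
  haveI : Finite (geomTorsion W (((3 : ℕ) : ℤ) ^ k' * ((3 : ℕ) : ℤ))) := finite_geomTorsion_pow_mul W 3 k'
  -- the `ℤ/3^1`-module `E[3]`
  haveI hF : Fact (Nat.Prime (3 ^ 1)) := ⟨by norm_num⟩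
  letI : Module (ZMod (3 ^ 1)) (geomTorsion W ((3 : ℕ) : ℤ)) :=
    (inferInstance : Module (ZMod 3) (geomTorsion W ((3 : ℕ) : ℤ)))
  haveI : Module.Finite (ZMod (3 ^ 1)) (geomTorsion W ((3 : ℕ) : ℤ)) := Module.Finite.of_finite
  -- the Weil datum, the `3`-descent finiteness / self-duality count, the core rank
  obtain ⟨e, hμ, hadd₁, hadd₂, halt, hnondeg, hgal⟩ :=
    exists_weilPairing_holds W 3 (by norm_num) (by norm_num)
  let T : Finset (HeightOneSpectrum (𝓞 ℚ)) := S.preimage Sum.inr Sum.inr_injective.injOn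
  have h3T : ∀ v : HeightOneSpectrum (𝓞 ℚ), ((3 : ℕ) : 𝓞 ℚ) ∈ v.asIdeal → v ∈ T :=
    fun v hv => Finset.mem_preimage.mpr (h3S v hv)
  have hbadT : ∀ v : HeightOneSpectrum (𝓞 ℚ), ¬ W.HasGoodReductionAt v → v ∈ T :=
    fun v hv => Finset.mem_preimage.mpr (hbadS v hv)
  have hKfin : Finite (W.kummerSelmerStructure ((3 : ℕ) : ℤ)).selmerGroup := by
    rw [← selmerGroup_eq_selmerGroup_kummerSelmerStructure]
    exact W.finite_selmerGroup_holds (by norm_num)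
  haveI := hKfin
  have hKSD := natCard_selmerGroup_kummer_eq_dual W 3 e hμ hadd₁ hadd₂ hgal halt hnondeg
    Nat.prime_three.isPrimePow (by decide) inv (fun v => (hperf v).1.injective) hEP
  have hCR : LocalInvariants.HasCoreRank inv (propagatedSelmerStructureOne W 3) 3 1 :=
    hasCoreRank_one_propagatedSelmerStructureOne W inv hperf hsum hcompl T h3T hbadT
      (fun v hv => bounded_pPrimaryTorsion_localGaloisModule_rat W 3 hv) hKfin hKSD
      (fun v hv => natCard_propagatedSelmerStructureOne_three W v (hEP v) hv)
  have hco := isResiduallyCoisotropic_propagatedSelmerStructureOne_three W e hμ hadd₁ hadd₂ hgal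
    halt hnondeg inv hperf S (fun v _ => hEP v)
  -- `ker ρ_{E[3^{k′+1}]} ≤ ker ρ_{E[3]}` and (H.3′) on the deep group, from irreducibility
  have hker : ∀ u : absoluteGaloisGroup ℚ,
      W.torsionGaloisModule (((3 : ℕ) : ℤ) ^ k' * ((3 : ℕ) : ℤ)) u = 1 →
        W.torsionGaloisModule ((3 : ℕ) : ℤ) u = 1 :=
    fun u hu => S24Deep.torsionGaloisModule_eq_one_of_dvd W (Dvd.intro_left _ rfl) u hu
  have hirr := hasIrreducibleModPGaloisRep_of_hasSurjectiveModNGaloisRep W 3 h3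
  -- the DEEP slice theorem at `m = 1`, `T = T̄ = E[3]`, identity residual pair, `T′ = E[3^{k′}·3]`
  have h := kolyvaginSystems_freeRankOne_zmod_three_pow_deep_at_one
    (geomTorsion W ((3 : ℕ) : ℤ)) (geomTorsion W ((3 : ℕ) : ℤ))
    (geomTorsion W (((3 : ℕ) : ℤ) ^ k' * ((3 : ℕ) : ℤ))) (k' + 1)
    (W.torsionGaloisModule _) (W.torsionGaloisModule _) (W.torsionGaloisModule _)
    ContIntertwiningMap.id ContIntertwiningMap.id
    τ (weilDualIntertwining W 3 e hμ hadd₁ hadd₂ hgal) inv S (propagatedSelmerStructureOne W 3) D η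
    (Nat.succ_le_succ (Nat.zero_le k')) hker
    (fun x => ⟨x, rfl⟩) (id_eq_zero_iff_exists W) (id_id_eq_pow_smul W)
    (residual_irreducible_of_surj W 3 h3) hτμ (by simpa using hτq)
    (fun f hf => hH3_three_pow_of_irr W hirr k' f hf)
    (weilDualHom_bijective W 3 e hμ hadd₁ hadd₂ hnondeg)
    hperf hsum hunro hcompl hS (fun v hv => not_mem_and_isUnramifiedAt_three_of_not_mem W S h3S hbadS hv)
    (fun v hv => (not_mem_and_isUnramifiedAt_of_not_mem W 3 k' S h3S hbadS hv).2)
    (propagatedSelmerStructureOne_three_isUnramifiedOutside W S hS h3S hbadS)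
    (IdPair.isCartesian_id _ S) (by rw [IdPair.induced_id]; exact hCR)
    (by rw [IdPair.induced_id]; exact hco) hP hT (by simpa using hD)
  refine ⟨by simpa using h.1, fun d hd hlam => h.2 d hd ?_⟩
  rwa [IdPair.induced_id]

/-! ### §2 Rigidity at a GENERAL core vertex on a deep-class datum of `E[3]` -/

/-- **Injectivity at ANY core vertex on `(E[3], 𝓕̄_can)` for a datum with DEEP primes
`frobeniusClassPrimes (E[3^{k′}·3]) {v | inr v ∈ S} τ 3^{k′+1}` — NO [S24] binder, no tower** (LITERALLY
the `hinj₁` of n1011's `TorsionLevel.apply_eq_zero_of_apply_eq_zero_allDepths_le` /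
`injective_eval_kolyvaginSystems_allDepths_le` for such data): if `λ^*(n₀) = 0` then every Kolyvagin
system with `κ_{n₀} = 0` vanishes at every level (injectivity half of §1's bijection at `n₀`; a system
off the levels is `0` there by definition). n1011's `…_of_baseRigidity_deep` is the case `n₀ = ∅`.
[cite: Sakamoto2024, Thm. 4.4 (1) (p. 926), §6 Thm. 6.7 (p. 932)] [cite: Rubin2011, Cor. 2.8.9 (2) (p. 25)] -/
theorem kolyvaginSystem_eq_zero_of_apply_core_eq_zero_deep
    [Finite (geomTorsion W ((3 : ℕ) : ℤ))]
    (h3 : W.HasSurjectiveModNGaloisRep ((3 : ℕ) : ℤ)) (k' : ℕ)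
    (τ : absoluteGaloisGroup ℚ) (hτμ : τ ∈ rootsOfUnityFixer ℚ (3 ^ (k' + 1)))
    (hτq : Nonempty (cokerSubOne (W.torsionGaloisModule ((3 : ℕ) : ℤ)) τ ≃+ ZMod 3))
    (inv : LocalInvariants ℚ 3) (hperf : inv.IsPerfect) (hsum : inv.SumLocalTermEqZero)
    (hunro : inv.UnramifiedOrthogonal) (hcompl : inv.SelmerComplement)
    (hEP : ∀ v : HeightOneSpectrum (𝓞 ℚ), localEulerPoincareCharacteristic (v.adicCompletion ℚ))
    (S : Finset (Place ℚ)) (hS : ∀ w : InfinitePlace ℚ, (Sum.inl w : Place ℚ) ∈ S)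
    (h3S : ∀ v : HeightOneSpectrum (𝓞 ℚ), ((3 : ℕ) : 𝓞 ℚ) ∈ v.asIdeal → (Sum.inr v : Place ℚ) ∈ S)
    (hbadS : ∀ v : HeightOneSpectrum (𝓞 ℚ), ¬ W.HasGoodReductionAt v → (Sum.inr v : Place ℚ) ∈ S)
    (D : KolyvaginDatum (W.torsionGaloisModule ((3 : ℕ) : ℤ)))
    (η : (q : HeightOneSpectrum (𝓞 ℚ)) → (ZMod (Ideal.absNorm q.asIdeal))ˣ)
    (hP : D.primes = frobeniusClassPrimes (W.torsionGaloisModule (((3 : ℕ) : ℤ) ^ k' * ((3 : ℕ) : ℤ)))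
      {v | (Sum.inr v : Place ℚ) ∈ S} τ (3 ^ (k' + 1)))
    (hT : D.transverse = cyclotomicTransverse (W.torsionGaloisModule ((3 : ℕ) : ℤ)))
    (hD : D.HasCanonicalComparison 3 η)
    {n₀ : Finset (HeightOneSpectrum (𝓞 ℚ))} (hn₀ : D.IsLevel n₀)
    (hcore : LocalInvariants.lambdaStar inv (D.atLevel (propagatedSelmerStructureOne W 3) n₀) 3 = 0) :
    ∀ κ : Finset (HeightOneSpectrum (𝓞 ℚ)) → galoisCohomology (W.torsionGaloisModule ((3 : ℕ) : ℤ)) 1,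
      D.IsKolyvaginSystem (propagatedSelmerStructureOne W 3) κ → κ n₀ = 0 → ∀ n, κ n = 0 := by
  intro κ hκ hκ₀ n
  obtain ⟨-, hbij⟩ := kolyvaginSystems_freeRankOne_propagatedSelmerStructureOne_deep_atOne_of_surj W h3
    k' τ hτμ hτq inv hperf hsum hunro hcompl hEP S hS h3S hbadS D η hP hT hD
  have hinj := (hbij n₀ hn₀ hcore).1
  let κ' : D.kolyvaginSystems (propagatedSelmerStructureOne W 3) :=
    ⟨κ, (KolyvaginDatum.mem_kolyvaginSystems_iff D _ κ).mpr hκ⟩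
  have h0 : κ' = 0 := by
    apply hinj
    apply Subtype.ext
    change κ n₀ = (0 : Finset (HeightOneSpectrum (𝓞 ℚ)) →
      galoisCohomology (W.torsionGaloisModule ((3 : ℕ) : ℤ)) 1) n₀
    rw [hκ₀]
    rfl
  have hκeq : κ = 0 := congrArg Subtype.val h0
  rw [hκeq]
  rfl

end Summit.BirchSwinnertonDyer.BirchSwinnertonDyer.Theorems.KimAtThreeDeepLowerS24DeepTorsionAtOne

end
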